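import Summits.MatrixMultiplication.MatrixMultiplication.Theorems.FarEdgeDescentTower
import HarnessLib

/-!
# Route `FarEdgeDescent` — the eleventh-power tower: `ω(1,k,1) − (k+1) = O(k^{−log 2/log 11})` (kernel XXV-a)

decomp-mm ROOT cell (D-0178), lens 2 «structural dichotomy: special vs generic», gen 49.  THESES-FREE
(imports `Literature` and the theses-free kernel XXIV `FarEdgeDescentTower` only).  Write
`e(x) = ω(1,x,1) − (x+1) ≥ 0` (`ω(1,x,1) = omegaRect K 1 x 1`, any field `K`).

THE SHARPENING (critic decomp-mm-crit-1 g15, s1/c1 on kernel XXIV).  Kernel XXIV propagates a certificate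
`bR(⟨c⟩ ⊗ ⟨A,M,A⟩) ≤ Λ·cAM` through (crude CW82 augmentation `q = (Λ−1)·cAM` → one-anchor-letter class of the
`N`‑th Kronecker power → Kronecker square); the fixed-point inequality is
`(Λ+1)^{2N} ≤ Λ·N²·(Λ−1)^{2N−2}` and the resulting rate is `e(k) ≤ 2^{−j}` for `k ≥ 3·N^j − 3`, true order
`log 2/log N`.  XXIV used `N = 15, Λ = 29`.  Here `N = 11, Λ = 31`:
`32^22 = 1.2981·10^33 ≤ 31·121·30^20 = 1.3079·10^33` (`tower_step`), base `bR(⟨1⟩⊗⟨31,1,31⟩) ≤ 961`,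
invariants `121c ≤ A²`, `M·A³ ≤ A^{3·11^j}` (`tower`), readout with a general ratio `Λ`
(`excess_le_of_cert_ratio`, the `Λ`‑version of XXIV's `excess_le_of_cert`), hence
`e(k) ≤ 2^{−j}` for real `k ≥ 3·11^j − 3` (`excess_le_inv_two_pow`) and, AT THE TRUE ORDER
`δ₁₁ = log 2/log 11 = 0.28906…` (`11^{δ₁₁} = 2`), `e(k) ≤ 33^{δ₁₁}·k^{−δ₁₁}` for every integer `k ≥ 1`
(`excess_le_rpow_trueOrder`; `33^{δ₁₁} = 2.75…`), with the clean rational rung `e(k) ≤ 3·k^{−2/7}`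
(`excess_le_three_mul_rpow_two_sevenths`, `2/7 = 0.2857…`) and the `RateBeyond θ` form of the dial of kernel
XXV-b for every `θ < δ₁₁` (`rateBeyond_of_lt_trueOrder`).
FAMILY CEILING (why 11): with the square, feasibility needs `min_Λ ((Λ+1)/(Λ−1))^{2N−2}(Λ+1)²/Λ ≤ N²`;
for `N = 10` the minimum is `≈ 103.4 > 100` (at `Λ ≈ 39`), for `N = 11`, `Λ = 31` gives `120.1 ≤ 121`; a
`p`‑th Kronecker power instead of the square needs `N ≳ e^{p−1}(2p/(p−1))^{p−1}` and yields order
`log p/log N`, maximal at `p = 2, N = 11`.  So `δ₁₁` is the ceiling of the one-anchor-letter tower family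
(cell memo NODE-g49, instrument `tower_family.json`); beyond it the special leaf is IDEA-NEEDED.
NO definitions (gate rule D-0009).
[cite: CoppersmithWinograd1982, Thm. 1] [cite: KnuthTAOCP2, §4.6.4, Ex. 67(e),(g)]
[cite: LottiRomani1983, Prop. 3.3, Prop. 4.1] [cite: Blaser2013, Thm. 7.5]
-/

set_option linter.dupNamespace false

noncomputable section

open scoped BigOperators

namespace Summit.MatrixMultiplication.MatrixMultiplication.Theorems.FarEdgeDescentTowerEleven

open Literature.Computability.AlgebraicComplexity
open Literature.Barriers.MatrixMultiplication
open Summit.MatrixMultiplication.MatrixMultiplication.Theorems.FarEdgeDescentTower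

variable (K : Type) [Field K]

/-! ## §1 One stage of the eleventh-power tower -/

/-- **The stage (`N = 11`, `Λ = 31`).**  A certificate `bR(⟨c⟩ ⊗ ⟨A,M,A⟩) ≤ 31·cAM` propagates to
`bR(⟨(11c)²⟩ ⊗ ⟨A², (M q¹⁰)², A²⟩) ≤ 31·(11c)²·A²·(Mq¹⁰)²` with `q = 30·cAM`: crude augmentation
(`bR(⟨1,q,1⟩ ⊕ ⊕_c⟨A,M,A⟩) ≤ 32cAM`), the one-anchor-letter type class of the 11‑th power
(`⟨11c⟩ ⊗ ⟨A, Mq¹⁰, A⟩`), the Kronecker square, and `32^22 ≤ 31·121·30^20`.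
[cite: LottiRomani1983, Prop. 3.3] [cite: KnuthTAOCP2, §4.6.4, Ex. 67(g)] -/
theorem tower_step {c A M X q : ℕ} (hX : X = c * (A * M)) (hq : q = 30 * X)
    (h : algBorderRank (kroneckerTensor (unitTensor K c) (matMulTensor K A M A)) ≤ 31 * X) :
    algBorderRank (kroneckerTensor (unitTensor K ((11 * c) ^ 2))
        (matMulTensor K (A ^ 2) ((M * q ^ 10) ^ 2) (A ^ 2))) ≤
      31 * ((11 * c) ^ 2 * (A ^ 2 * (M * q ^ 10) ^ 2)) := by
  classical
  -- (a) the direct sum of `c` blocks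
  have hds : algBorderRank (matMulDirectSum K (fun _ : Fin c => A) (fun _ => M) (fun _ => A)) ≤
      31 * X := (tensorRestrictsTo_multiple_directSum K c A M).algBorderRank_le.trans h
  -- (b) the crude augmentation by `⟨1, q, 1⟩`
  set D := matMulDirectSum K (Fin.cons 1 (fun _ : Fin c => A)) (Fin.cons q (fun _ : Fin c => M))
    (Fin.cons 1 (fun _ : Fin c => A)) with hD
  have hsumY : ∑ _i : Fin c, M * A = X := by
    rw [Finset.sum_const, Finset.card_univ, Fintype.card_fin, smul_eq_mul, hX]; ring
  have hsumX : ∑ _i : Fin c, A * M = X := by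
    rw [Finset.sum_const, Finset.card_univ, Fintype.card_fin, smul_eq_mul, hX]
  have haug : algBorderRank D ≤ 31 * X + X := by
    have h' := algBorderRank_cons_inner_le_of_le K (fun _ : Fin c => A) (fun _ => M) (fun _ => A)
      hds (q := q) (by rw [hsumY]; omega)
    rwa [hsumX] at h'
  -- (c) the words with exactly one anchor letter: position `(e β).1`, anchor block `(e β).2`
  set e : Fin (11 * c) → Fin 11 × Fin c := fun β => finProdFinEquiv.symm β with he
  set rep : Fin (11 * c) → Fin 11 → Fin (c + 1) :=
    fun β j => if j = (e β).1 then ((e β).2).succ else 0 with hrep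
  have hinj : Function.Injective rep := by
    intro β β' hββ'
    have h1 := congrFun hββ' (e β).1
    simp only [hrep, if_true] at h1
    have hpos : (e β).1 = (e β').1 := by
      by_contra hne
      rw [if_neg hne] at h1
      exact Fin.succ_ne_zero _ h1
    rw [hpos, if_pos rfl] at h1
    have hblk : (e β).2 = (e β').2 := Fin.succ_inj.1 h1
    exact finProdFinEquiv.symm.injective (Prod.ext hpos hblk)
  have hK : ∀ β, ∏ j, (Fin.cons 1 (fun _ : Fin c => A) : Fin (c + 1) → ℕ) (rep β j) = A := by
    intro β
    have hf : (fun j => (Fin.cons 1 (fun _ : Fin c => A) : Fin (c + 1) → ℕ) (rep β j)) =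
        fun j => if j = (e β).1 then A else 1 := funext fun j => by
      simp only [hrep]; split_ifs <;> simp
    rw [hf, Finset.prod_ite_eq']; simp
  have hN : ∀ β, ∏ j, (Fin.cons 1 (fun _ : Fin c => A) : Fin (c + 1) → ℕ) (rep β j) = A := hK
  have hM : ∀ β, ∏ j, (Fin.cons q (fun _ : Fin c => M) : Fin (c + 1) → ℕ) (rep β j) =
      M * q ^ 10 := by
    intro β
    have hf : (fun j => (Fin.cons q (fun _ : Fin c => M) : Fin (c + 1) → ℕ) (rep β j)) =
        fun j => if j = (e β).1 then M else q := funext fun j => by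
      simp only [hrep]; split_ifs <;> simp
    rw [hf, Fin.prod_univ_succAbove _ (e β).1, if_pos rfl,
      Finset.prod_congr rfl fun j _ => if_neg (Fin.succAbove_ne (e β).1 j), Finset.prod_const,
      Finset.card_univ, Fintype.card_fin]
  have hcls : TensorRestrictsTo (kroneckerPow D 11)
      (kroneckerTensor (unitTensor K (11 * c)) (matMulTensor K A (M * q ^ 10) A)) :=
    tensorRestrictsTo_kroneckerPow_matMulDirectSum_multiple K _ _ _ rep hinj hK hM hN
  -- (d) the Kronecker square, (e) the arithmetic of the fixed point
  have hsq := tensorRestrictsTo_kroneckerPow_multiple_matMulTensor K (11 * c) A (M * q ^ 10) A 2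
  set T := kroneckerTensor (unitTensor K (11 * c)) (matMulTensor K A (M * q ^ 10) A) with hT
  calc algBorderRank (kroneckerTensor (unitTensor K ((11 * c) ^ 2))
          (matMulTensor K (A ^ 2) ((M * q ^ 10) ^ 2) (A ^ 2)))
        ≤ algBorderRank (kroneckerPow T 2) := hsq.algBorderRank_le
    _ ≤ algBorderRank T ^ 2 := algBorderRank_kroneckerPow_le T 2
    _ ≤ algBorderRank (kroneckerPow D 11) ^ 2 := Nat.pow_le_pow_left hcls.algBorderRank_le 2
    _ ≤ (algBorderRank D ^ 11) ^ 2 := Nat.pow_le_pow_left (algBorderRank_kroneckerPow_le D 11) 2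
    _ ≤ ((31 * X + X) ^ 11) ^ 2 := Nat.pow_le_pow_left (Nat.pow_le_pow_left haug 11) 2
    _ = 32 ^ 22 * X ^ 22 := by ring
    _ ≤ (31 * 11 ^ 2 * 30 ^ 20) * X ^ 22 := Nat.mul_le_mul_right _ (by norm_num)
    _ = 31 * ((11 * c) ^ 2 * (A ^ 2 * (M * q ^ 10) ^ 2)) := by rw [hq, hX]; ring

/-! ## §2 The readout with a general ratio -/

/-- **Readout, general ratio `Λ ≥ 1`.**  A certificate `bR(⟨c⟩ ⊗ ⟨A,M,A⟩) ≤ Λ·cAM` (`c, M ≥ 1`, `A ≥ 2`)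
bounds the far-edge excess by `e(k) ≤ log Λ / log A` for every real `k ≥ log M / log A` (the `Λ`‑version
of kernel XXIV's `excess_le_of_cert`: rectangular asymptotic sum inequality with multiplicity at
`x* = log M/log A`, `R̃ ≤ bR`, antitonicity of `x ↦ ω(1,x,1) − x`).
[cite: AlmanDuanVassilevskaWilliamsXuXuZhou2025, Thm. 3.2] [cite: LottiRomani1983, Prop. 4.1] -/
theorem excess_le_of_cert_ratio {Λ c A M X : ℕ} (hΛ : 1 ≤ Λ) (hc : 1 ≤ c) (hA : 2 ≤ A) (hM : 1 ≤ M)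
    (hX : X = c * (A * M))
    (h : algBorderRank (kroneckerTensor (unitTensor K c) (matMulTensor K A M A)) ≤ Λ * X)
    {k : ℝ} (hk : Real.log M / Real.log A ≤ k) :
    omegaRect K 1 k 1 - (k + 1) ≤ Real.log Λ / Real.log A := by
  have hA0 : (0 : ℝ) < A := by exact_mod_cast (by omega : 0 < A)
  have hM0 : (0 : ℝ) < M := by exact_mod_cast (by omega : 0 < M)
  have hc0 : (0 : ℝ) < c := by exact_mod_cast (by omega : 0 < c)
  have hΛ0 : (0 : ℝ) < Λ := by exact_mod_cast (by omega : 0 < Λ)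
  have hlA : 0 < Real.log A := Real.log_pos (by exact_mod_cast (by omega : 1 < A))
  have hlM : 0 ≤ Real.log M := Real.log_nonneg (by exact_mod_cast hM)
  set x : ℝ := Real.log M / Real.log A with hx
  have hx0 : 0 ≤ x := div_nonneg hlM hlA.le
  have hxA : x * Real.log A = Real.log M := div_mul_cancel₀ _ hlA.ne'
  have hAx : (A : ℝ) ^ x ≤ (M : ℕ) := by
    rw [Real.rpow_def_of_pos hA0, mul_comm, hxA, Real.exp_log hM0]
  have h1 := mul_rpow_omegaRect_mid_le_asymptoticRank K hx0 hc hA hAx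
  have h2 : asymptoticRank (kroneckerTensor (unitTensor K c) (matMulTensor K A M A)) ≤
      ((Λ * X : ℕ) : ℝ) := by exact_mod_cast asymptoticRank_le_of_algBorderRank_le h
  have h3 : (A : ℝ) ^ omegaRect K 1 x 1 ≤ Λ * (A * M) := by
    have h12 := h1.trans h2
    rw [hX] at h12
    push_cast at h12
    have : (c : ℝ) * (A : ℝ) ^ omegaRect K 1 x 1 ≤ c * (Λ * (A * M)) := by nlinarith
    exact le_of_mul_le_mul_left this hc0
  have h4 : omegaRect K 1 x 1 * Real.log A ≤ Real.log Λ + Real.log A + Real.log M := by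
    have h' := Real.log_le_log (Real.rpow_pos_of_pos hA0 _) h3
    rw [Real.log_rpow hA0, Real.log_mul hΛ0.ne' (by positivity),
      Real.log_mul hA0.ne' hM0.ne'] at h'
    linarith
  have h5 : omegaRect K 1 x 1 - (x + 1) ≤ Real.log Λ / Real.log A := by
    rw [le_div_iff₀ hlA]
    nlinarith
  have h6 := omegaRect_one_mid_one_sub_antitone K hk
  simp only at h6
  linarith

/-! ## §3 The tower and its readout -/

/-- **The eleventh-power tower.**  Stage `j`: base `A = 31^{2^j}`, multiplicity `c ≥ 1` with `121c ≤ A²`,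
middle dimension `M ≥ 1` with `M·A³ ≤ A^{3·11^j}`, certificate `bR(⟨c⟩ ⊗ ⟨A,M,A⟩) ≤ 31·cAM`.
Base `bR(⟨1⟩ ⊗ ⟨31,1,31⟩) ≤ 961`; step = `tower_step`.
[cite: KnuthTAOCP2, §4.6.4, Ex. 67(g)] [cite: LottiRomani1983, Prop. 3.3] -/
theorem tower (j : ℕ) : ∃ c M : ℕ, 1 ≤ c ∧ 1 ≤ M ∧ 121 * c ≤ (31 ^ 2 ^ j) ^ 2 ∧
    M * (31 ^ 2 ^ j) ^ 3 ≤ (31 ^ 2 ^ j) ^ (3 * 11 ^ j) ∧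
    algBorderRank (kroneckerTensor (unitTensor K c) (matMulTensor K (31 ^ 2 ^ j) M (31 ^ 2 ^ j))) ≤
      31 * (c * (31 ^ 2 ^ j * M)) := by
  classical
  induction j with
  | zero =>
    refine ⟨1, 1, le_rfl, le_rfl, by norm_num, by norm_num, ?_⟩
    simp only [pow_zero, pow_one]
    have h1 : tensorRank (unitTensor K 1) ≤ 1 := by
      refine tensorRank_le_of_eq_sum (fun _ _ => (1 : K)) (fun _ _ => 1) (fun _ _ => 1) ?_
      funext a b c
      rw [unitTensor_one, Finset.sum_apply, Finset.sum_apply, Finset.sum_apply]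
      simp [triad_apply]
    calc algBorderRank (kroneckerTensor (unitTensor K 1) (matMulTensor K 31 1 31))
        ≤ algBorderRank (unitTensor K 1) * algBorderRank (matMulTensor K 31 1 31) :=
          algBorderRank_kroneckerTensor_le _ _
      _ ≤ 1 * (31 * 1 * 31) :=
          Nat.mul_le_mul ((algBorderRank_le_tensorRank _).trans h1)
            ((algBorderRank_le_tensorRank _).trans (tensorRank_matMulTensor_le K 31 1 31))
      _ = 31 * (1 * (31 * 1)) := by norm_num
  | succ j ih =>
    obtain ⟨c, M, hc, hM, hcA, hMA, hcert⟩ := ih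
    rw [show 31 ^ 2 ^ (j + 1) = (31 ^ 2 ^ j) ^ 2 by rw [pow_succ, pow_mul]]
    have hApos : 0 < 31 ^ 2 ^ j := by positivity
    generalize 31 ^ 2 ^ j = A at hcA hMA hcert hApos ⊢
    have hstep := tower_step K (X := c * (A * M)) (q := 30 * (c * (A * M))) rfl rfl hcert
    have h30 : 30 * c ≤ A ^ 2 := (Nat.mul_le_mul_right c (by norm_num : 30 ≤ 121)).trans hcA
    have hq0 : 0 < M * (30 * (c * (A * M))) ^ 10 := by positivity
    refine ⟨(11 * c) ^ 2, (M * (30 * (c * (A * M))) ^ 10) ^ 2, Nat.one_le_pow _ _ (by omega),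
      Nat.one_le_pow _ _ hq0, ?_, ?_, hstep⟩
    · calc 121 * (11 * c) ^ 2 = (121 * c) ^ 2 := by ring
        _ ≤ (A ^ 2) ^ 2 := Nat.pow_le_pow_left hcA 2
    · calc (M * (30 * (c * (A * M))) ^ 10) ^ 2 * (A ^ 2) ^ 3
          = (30 * c) ^ 20 * (A ^ 26 * M ^ 22) := by ring
        _ ≤ (A ^ 2) ^ 20 * (A ^ 26 * M ^ 22) := Nat.mul_le_mul_right _ (Nat.pow_le_pow_left h30 20)
        _ = (M * A ^ 3) ^ 22 := by ring
        _ ≤ (A ^ (3 * 11 ^ j)) ^ 22 := Nat.pow_le_pow_left hMA 22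
        _ = (A ^ 2) ^ (3 * 11 ^ (j + 1)) := by
          rw [← pow_mul, ← pow_mul, pow_succ]; ring_nf

/-- **`e(k) ≤ 2^{−j}` for every real `k ≥ 3·11^j − 3`** (readout of stage `j`: `log M_j/log A_j ≤ 3·11^j − 3`
and `log 31/log A_j = 2^{−j}`), every field. [cite: LottiRomani1983, Prop. 4.1] -/
theorem excess_le_inv_two_pow (j : ℕ) {k : ℝ} (hk : 3 * (11 : ℝ) ^ j - 3 ≤ k) :
    omegaRect K 1 k 1 - (k + 1) ≤ 1 / (2 : ℝ) ^ j := by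
  obtain ⟨c, M, hc, hM, -, hMA, hcert⟩ := tower K j
  have hA2 : 2 ≤ 31 ^ 2 ^ j := le_trans (by norm_num) (Nat.le_self_pow (by positivity) 31)
  have hlog : Real.log ((31 ^ 2 ^ j : ℕ) : ℝ) = (2 : ℝ) ^ j * Real.log 31 := by
    push_cast
    rw [Real.log_pow]; push_cast; ring
  generalize 31 ^ 2 ^ j = A at hA2 hlog hMA hcert
  have hA0 : (0 : ℝ) < A := by exact_mod_cast (by omega : 0 < A)
  have hlA : 0 < Real.log (A : ℝ) := Real.log_pos (by exact_mod_cast (by omega : 1 < A))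
  have hM0 : (0 : ℝ) < M := by exact_mod_cast (by omega : 0 < M)
  have hthr : Real.log M / Real.log (A : ℝ) ≤ 3 * (11 : ℝ) ^ j - 3 := by
    rw [div_le_iff₀ hlA]
    have h' : (M : ℝ) * (A : ℝ) ^ 3 ≤ (A : ℝ) ^ (3 * 11 ^ j) := by exact_mod_cast hMA
    have h'' := Real.log_le_log (by positivity) h'
    rw [Real.log_mul hM0.ne' (by positivity), Real.log_pow, Real.log_pow] at h''
    push_cast at h''
    linarith
  have h := excess_le_of_cert_ratio K (Λ := 31) (by norm_num) hc hA2 hM rfl hcert (hthr.trans hk)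
  rw [hlog] at h
  have hl31 : 0 < Real.log 31 := Real.log_pos (by norm_num)
  calc omegaRect K 1 k 1 - (k + 1) ≤ Real.log 31 / ((2 : ℝ) ^ j * Real.log 31) := h
    _ = 1 / (2 : ℝ) ^ j := by field_simp

/-! ## §4 The rate at the true order `log 2 / log 11`, and the clean rung `3·k^{−2/7}` -/

/-- **`e(k) ≤ 33^{δ₁₁}·k^{−δ₁₁}` for every integer `k ≥ 1`, `δ₁₁ = log 2/log 11`** (`= 0.28906…`,
`33^{δ₁₁} = 2.75…`), every field: stage `j = ⌊log₁₁((k+3)/3)⌋` has `3·11^j − 3 ≤ k < 33·11^j`, and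
`2^{−j} = (11^j)^{−δ₁₁} ≤ (k/33)^{−δ₁₁}` since `11^{δ₁₁} = 2`.  The TRUE ORDER of the eleventh-power tower.
[cite: LottiRomani1983, Prop. 4.1] [cite: CoppersmithWinograd1982, Thm. 1] -/
theorem excess_le_rpow_trueOrder (k : ℕ) (hk : 1 ≤ k) :
    omegaRect K 1 k 1 - (k + 1) ≤
      (33 : ℝ) ^ (Real.log 2 / Real.log 11) * (k : ℝ) ^ (-(Real.log 2 / Real.log 11)) := by
  set δ : ℝ := Real.log 2 / Real.log 11 with hδ
  set j := Nat.log 11 ((k + 3) / 3) with hj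
  have hlow : 11 ^ j ≤ (k + 3) / 3 := Nat.pow_log_le_self 11 (by omega)
  have hup : (k + 3) / 3 < 11 ^ (j + 1) := Nat.lt_pow_succ_log_self (by norm_num) _
  have hlow' : 3 * 11 ^ j ≤ k + 3 := by omega
  have hup' : k < 33 * 11 ^ j := by
    have h1 : k + 3 < 3 * 11 ^ (j + 1) := by omega
    rw [pow_succ] at h1; omega
  have hk0 : (0 : ℝ) < k := by exact_mod_cast (by omega : 0 < k)
  have he := excess_le_inv_two_pow K j (k := (k : ℝ))
    (by have : ((3 * 11 ^ j : ℕ) : ℝ) ≤ ((k + 3 : ℕ) : ℝ) := by exact_mod_cast hlow'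
        push_cast at this; linarith)
  have hl2 : 0 < Real.log 2 := Real.log_pos (by norm_num)
  have hl11 : 0 < Real.log 11 := Real.log_pos (by norm_num)
  have hδ0 : 0 < δ := div_pos hl2 hl11
  -- `11^δ = 2`, hence `2^j = (11^j)^δ`
  have h11 : (11 : ℝ) ^ δ = 2 := by
    rw [Real.rpow_def_of_pos (by norm_num : (0 : ℝ) < 11), hδ, mul_div_cancel₀ _ hl11.ne',
      Real.exp_log (by norm_num : (0 : ℝ) < 2)]
  have h2j : (2 : ℝ) ^ j = ((11 : ℝ) ^ j) ^ δ := by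
    rw [← h11, ← Real.rpow_natCast ((11 : ℝ) ^ δ) j, ← Real.rpow_mul (by norm_num) δ (j : ℝ),
      mul_comm, Real.rpow_natCast_mul (by norm_num : (0 : ℝ) ≤ 11) j δ]
  -- `k/33 < 11^j`, so `(11^j)^{−δ} ≤ (k/33)^{−δ} = 33^δ·k^{−δ}`
  have hkj : (k : ℝ) / 33 ≤ (11 : ℝ) ^ j := by
    rw [div_le_iff₀ (by norm_num : (0 : ℝ) < 33)]
    have : ((k : ℕ) : ℝ) ≤ ((33 * 11 ^ j : ℕ) : ℝ) := by exact_mod_cast hup'.le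
    push_cast at this; linarith
  have hk33 : 0 < (k : ℝ) / 33 := by positivity
  calc omegaRect K 1 k 1 - (k + 1) ≤ 1 / (2 : ℝ) ^ j := he
    _ = ((11 : ℝ) ^ j) ^ (-δ) := by rw [h2j, Real.rpow_neg (by positivity), one_div]
    _ ≤ ((k : ℝ) / 33) ^ (-δ) := Real.rpow_le_rpow_of_nonpos hk33 hkj (by linarith)
    _ = (33 : ℝ) ^ δ * (k : ℝ) ^ (-δ) := by
      rw [Real.div_rpow hk0.le (by norm_num) (-δ), Real.rpow_neg (by norm_num : (0 : ℝ) ≤ 33),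
        div_inv_eq_mul, mul_comm]

/-- **The special leaf of the rate–transport dial (kernel XXV-b) below the true order**: for every
`θ < log 2/log 11`, `RateBeyond θ` holds — `∃ δ C, θ < δ ∧ ∀ k ≥ 1, e(k) ≤ C·k^{−δ}` (take `δ = log 2/log 11`,
`C = 33^δ`).  The shape is the route item `PowerAmortisation` (stmt-MatrixMultiplication-25347, `0 < δ`) with
`0` replaced by `θ`. [cite: LottiRomani1983, Prop. 4.1] -/
theorem rateBeyond_of_lt_trueOrder {θ : ℝ} (hθ : θ < Real.log 2 / Real.log 11) :
    ∃ δ C : ℝ, θ < δ ∧ ∀ k : ℕ, 1 ≤ k →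
      omegaRect K 1 k 1 - (k + 1) ≤ C * (k : ℝ) ^ (-δ) :=
  ⟨Real.log 2 / Real.log 11, (33 : ℝ) ^ (Real.log 2 / Real.log 11), hθ,
    fun k hk => excess_le_rpow_trueOrder K k hk⟩

/-- **The clean rung `ω(1,k,1) − (k+1) ≤ 3·k^{−2/7}` for every integer `k ≥ 1`**, every field
(`k < 33·11^j` gives `k² < 1089·121^j ≤ 2187·128^j = (3·2^j)^7`, so `k^{2/7} ≤ 3·2^j`; `2/7 = 0.2857… <
log 2/log 11`).  Supersedes kernel XXIV's `3·k^{−1/4}`. [cite: LottiRomani1983, Prop. 4.1] -/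
theorem excess_le_three_mul_rpow_two_sevenths (k : ℕ) (hk : 1 ≤ k) :
    omegaRect K 1 k 1 - (k + 1) ≤ 3 * (k : ℝ) ^ (-(2 / 7 : ℝ)) := by
  set j := Nat.log 11 ((k + 3) / 3) with hj
  have hlow : 11 ^ j ≤ (k + 3) / 3 := Nat.pow_log_le_self 11 (by omega)
  have hup : (k + 3) / 3 < 11 ^ (j + 1) := Nat.lt_pow_succ_log_self (by norm_num) _
  have hlow' : 3 * 11 ^ j ≤ k + 3 := by omega
  have hup' : k < 33 * 11 ^ j := by
    have h1 : k + 3 < 3 * 11 ^ (j + 1) := by omega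
    rw [pow_succ] at h1; omega
  have hup2 : k ^ 2 ≤ 2187 * 128 ^ j := by
    calc k ^ 2 ≤ (33 * 11 ^ j) ^ 2 := Nat.pow_le_pow_left hup'.le 2
      _ = 1089 * 121 ^ j := by rw [mul_pow, ← pow_mul, mul_comm j 2, pow_mul]; norm_num
      _ ≤ 2187 * 128 ^ j := Nat.mul_le_mul (by norm_num) (Nat.pow_le_pow_left (by norm_num) j)
  have hk0 : (0 : ℝ) < k := by exact_mod_cast (by omega : 0 < k)
  have he := excess_le_inv_two_pow K j (k := (k : ℝ))
    (by have : ((3 * 11 ^ j : ℕ) : ℝ) ≤ ((k + 3 : ℕ) : ℝ) := by exact_mod_cast hlow'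
        push_cast at this; linarith)
  -- `k^{2/7} ≤ 3·2^j`
  have hroot : (k : ℝ) ^ (2 / 7 : ℝ) ≤ 3 * (2 : ℝ) ^ j := by
    have h1 : (k : ℝ) ^ (2 : ℕ) ≤ (3 * (2 : ℝ) ^ j) ^ (7 : ℕ) := by
      have : ((k ^ 2 : ℕ) : ℝ) ≤ ((2187 * 128 ^ j : ℕ) : ℝ) := by exact_mod_cast hup2
      push_cast at this
      calc (k : ℝ) ^ 2 ≤ 2187 * 128 ^ j := this
        _ = (3 * (2 : ℝ) ^ j) ^ (7 : ℕ) := by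
          rw [mul_pow, ← pow_mul, show (128 : ℝ) = 2 ^ 7 by norm_num, ← pow_mul]; ring
    have h2 := Real.rpow_le_rpow (by positivity) h1 (by norm_num : (0 : ℝ) ≤ 1 / 7)
    rw [← Real.rpow_natCast, ← Real.rpow_natCast, ← Real.rpow_mul hk0.le,
      ← Real.rpow_mul (by positivity), show ((7 : ℕ) : ℝ) * (1 / 7) = 1 by norm_num,
      Real.rpow_one, show ((2 : ℕ) : ℝ) * (1 / 7) = (2 / 7 : ℝ) by norm_num] at h2
    exact h2
  have hkr : 0 < (k : ℝ) ^ (2 / 7 : ℝ) := Real.rpow_pos_of_pos hk0 _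
  calc omegaRect K 1 k 1 - (k + 1) ≤ 1 / (2 : ℝ) ^ j := he
    _ = 3 / (3 * (2 : ℝ) ^ j) := by field_simp
    _ ≤ 3 / (k : ℝ) ^ (2 / 7 : ℝ) := div_le_div_of_nonneg_left (by norm_num) hkr hroot
    _ = 3 * (k : ℝ) ^ (-(2 / 7 : ℝ)) := by rw [Real.rpow_neg hk0.le, div_eq_mul_inv]

end Summit.MatrixMultiplication.MatrixMultiplication.Theorems.FarEdgeDescentTowerEleven

end
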